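import Summits.AtomisticToContinuum.HydrodynamicLimit.Theorems.InformationPercolationEngineChaosClosesEulerReductionMomentum
import Summits.AtomisticToContinuum.HydrodynamicLimit.Theorems.InformationPercolationEngineChaosClosesEulerReductionEntropy
import Summits.AtomisticToContinuum.HydrodynamicLimit.Theorems.InformationPercolationEngineChaosClosesEulerReductionShellInputs
import Summits.AtomisticToContinuum.HydrodynamicLimit.Theorems.InformationPercolationEngineChaosClosesEulerReadoutEvents
import Summits.AtomisticToContinuum.HydrodynamicLimit.Theorems.JParityClosureLocalSecondLawRegularRangeTools
import HarnessLib

/-!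
# Kinetic reduction (crux `ChaosClosesEuler`, stmt-AtomisticToContinuum-15141, line `Sketch`,
# stub `stub_kineticReduction`) — helper: the deterministic core along one orbit

WHAT. THE PATHWISE STEP OF THE REDUCTION. Fix every tolerance. Along ONE good orbit lying off all bad events —
energy level `KE`, density cap on `[0, t_sh + e]`, collision tail, collision-rate deviations on the grid windows,
weak stress isotropy and collisional pressure deviations at the grid times, clamped local second law values at the
grid window starts, initial sup-closeness — the five hypotheses (H1)–(H5) of the BF18 shell hold for the cone field
`V = (ρ_r, m_r, e_r)` with the shell's defect `δ` (helpers `ReductionShellInputs`, `ReductionMomentum`,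
`ReductionEntropy`, the windowed quadratic collision functional from `kfac_windowQuad_le`), so the shell bounds every
window `[τ₀, τ₀ + Δ]`, and the `m + 1` windows tiling `[t, t + (m+1)Δ]` give the time-averaged `L¹` bound
(`reduction_pathwise`).

No named fact is invoked.
-/

noncomputable section

namespace Summit.AtomisticToContinuum.HydrodynamicLimit.Theorems.ChaosClosesEulerReduction

open scoped BigOperators Topology Classical MeasureTheory InnerProductSpace
open Filter Set MeasureTheory Function
open Literature.MathematicalPhysics.KineticTheory
open Literature.Analysis.FluidPDE
open Literature.Analysis.FunctionSpaces
open Summit.AtomisticToContinuum.HydrodynamicLimit.Theorems.LocalSecondLawNegative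
open Summit.AtomisticToContinuum.HydrodynamicLimit.Theorems.LocalSecondLawLedger
open Summit.AtomisticToContinuum.HydrodynamicLimit.Theorems.LocalSecondLawLedger.L (Mmom)

variable {N : ℕ}

/-! ## §1 The registered sub-goal: the error profile splits -/

/-- **Registered sub-goal `stub_reductionPathwise` (helper of `stub_kineticReduction`): the `L¹(dx)` error profile of
the conclusion is the `x`-integral of the sum of the three pointwise errors** (all three are continuous in `x`).
[folklore] -/
theorem stub_reductionPathwise : ∀ {N : ℕ} (r : ℝ) (w : Config (N + 1) (Fin 3) T3) {gρ ge : T3 → ℝ} {gm : T3 → V3}, Continuous gρ → Continuous gm → Continuous ge → (∫ x, |rhoC r w x - gρ x|) + (∫ x, ‖momC r w x - gm x‖) + (∫ x, |kinC r w x - ge x|) = ∫ x, (|rhoC r w x - gρ x| + ‖momC r w x - gm x‖ + |kinC r w x - ge x|) := by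
  intro N r w gρ ge gm hρ hm he
  have i1 : Integrable (fun x => |rhoC r w x - gρ x|) volume := ((continuous_rhoC r w).sub hρ).abs.integrable_unitAddTorus
  have i2 : Integrable (fun x => ‖momC r w x - gm x‖) volume := ((continuous_momC r w).sub hm).norm.integrable_unitAddTorus
  have i3 : Integrable (fun x => |kinC r w x - ge x|) volume := ((continuous_kinC r w).sub he).abs.integrable_unitAddTorus
  have e2 := integral_add (i1.add i2) i3
  simp only [Pi.add_apply] at e2
  rw [← integral_add i1 i2, ← e2]

/-! ## §2 The pathwise step -/

set_option maxHeartbeats 3200000 in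
/-- **THE PATHWISE STEP OF THE REDUCTION.** See the module docstring. [folklore] -/
theorem reduction_pathwise {σ : ℝ} (hσ : 0 < σ) (hσ2 : σ < 2⁻¹)
    (Φ : HardSphereFlow (Torus.geometry (Fin 3)) (hsDiameter σ N) (N + 1)) {z : Phase N} (hz : z ∈ Φ.good)
    {r : ℝ} (hr : 0 < r) (hr2 : r < 1 / 2)
    {T : ℝ} {ρ θ : ℝ → T3 → ℝ} {u : ℝ → T3 → V3} (hE : IsHardSphereEulerSolution σ T ρ u θ)
    {t Δ e : ℝ} {m : ℕ} (ht0 : 0 ≤ t) (hΔ : 0 < Δ) (he : 0 < e) (hT : t + (m + 1 : ℕ) * Δ + e < T)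
    -- the shell at this `σ`, horizon `t + (m+1)Δ`, window `Δ`, defect `δ`
    {η₁ a₁ b₁ ε' δ : ℝ} {χe f : ℝ → ℝ} (hχ : ContinuousOn χe (Ioi 0)) {B : ℝ} (hB0 : 0 ≤ B) (hB : ∀ a, 0 < a → |χe a| ≤ B)
    (hband : ∀ a, 0 < a → a * σ ^ 3 ≤ η₁ → χe a = hsCompressibility (a * σ ^ 3))
    (hfband : ∀ a, 0 < a → a * σ ^ 3 ≤ η₁ → f a = hsExcessFreeEnergy (a * σ ^ 3))
    (hFc : ContinuousOn (fun c => hsExcessFreeEnergy (min c η₁) + deriv hsExcessFreeEnergy η₁ * max (c - η₁) 0) (Ici 0))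
    (hSH : ∀ V : ℝ → T3 → ℝ × V3 × ℝ, Measurable (Function.uncurry V) →
      (∃ C : ℝ, ∀ s x, |(V s x).1| ≤ C ∧ ‖(V s x).2.1‖ ≤ C ∧ |(V s x).2.2| ≤ C) →
      (∀ s x, 0 ≤ (V s x).1) → (∀ s x, ‖(V s x).2.1‖ ^ 2 ≤ 2 * (V s x).1 * (V s x).2.2) →
      let θo : ℝ × V3 × ℝ → ℝ := fun U => 2 / 3 * (U.2.2 / U.1 - ‖U.2.1‖ ^ 2 / (2 * U.1 ^ 2))
      let pV : ℝ × V3 × ℝ → ℝ := fun U => U.1 * θo U * χe U.1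
      let Zs : ℝ × V3 × ℝ → ℝ := fun U => max a₁ (min (3 / 2 * Real.log (θo U) - Real.log U.1 - f U.1) b₁)
      let Etot : ℝ → T3 → ℝ := fun s x => totalEnergyDensity (ρ s x) (u s x) (θ s x)
      let cut : ℝ → ℝ → ℝ := fun τ₀ s => Real.smoothTransition ((τ₀ + Δ - s) / Δ)
      (∀ φ : ℝ → T3 → ℝ, Torus.IsSmoothSpaceTimeOn Set.univ φ → ∀ τ ∈ Set.Icc 0 (t + (m + 1 : ℕ) * Δ), (∫ x, φ τ x * (V τ x).1) - ∫ x, φ 0 x * (V 0 x).1 = ∫ s in Set.Icc 0 τ, ∫ x, (deriv (fun s' => φ s' x) s * (V s x).1 + ∑ k : Fin 3, (V s x).2.1 k * Torus.partialDeriv k (φ s) x)) →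
      (∀ τ ∈ Set.Icc 0 (t + (m + 1 : ℕ) * Δ), |(∫ x, ⟪u τ x, (V τ x).2.1⟫_ℝ) - (∫ x, ⟪u 0 x, (V 0 x).2.1⟫_ℝ) - ∫ s in Set.Icc 0 τ, ∫ x, (⟪Torus.timeDerivWithin (Set.Ico 0 T) u s x, (V s x).2.1⟫_ℝ + ∑ i : Fin 3, ∑ j : Fin 3, Torus.partialDeriv j (fun y => u s y i) x * ((V s x).2.1 i * (V s x).2.1 j / (V s x).1 + if i = j then pV (V s x) else 0))| ≤ δ) →
      (∀ τ₀ ∈ Set.Icc 0 (t + (m + 1 : ℕ) * Δ - Δ), (∫ s in Set.Icc 0 (t + (m + 1 : ℕ) * Δ), ∫ x, ((V s x).1 * Zs (V s x) * Torus.timeDerivWithin (Set.Ico 0 T) (fun s' y => θ s' y * cut τ₀ s') s x + Zs (V s x) * ⟪(V s x).2.1, Torus.gradient (fun y => θ s y * cut τ₀ s) x⟫_ℝ)) + ∫ x, (V 0 x).1 * Zs (V 0 x) * (θ 0 x * cut τ₀ 0) ≤ δ) →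
      (∀ τ ∈ Set.Icc 0 (t + (m + 1 : ℕ) * Δ), ∫ x, (V τ x).2.2 ≤ (∫ x, (V 0 x).2.2) + δ) →
      (∀ x, |(V 0 x).1 - ρ 0 x| ≤ δ ∧ ‖(V 0 x).2.1 - ρ 0 x • u 0 x‖ ≤ δ ∧ |(V 0 x).2.2 - Etot 0 x| ≤ δ) →
      ∀ τ₀ ∈ Set.Icc 0 (t + (m + 1 : ℕ) * Δ - Δ), ∫ s in Set.Icc τ₀ (τ₀ + Δ), ∫ x, (|(V s x).1 - ρ s x| + ‖(V s x).2.1 - ρ s x • u s x‖ + |(V s x).2.2 - Etot s x|) ≤ ε' * Δ)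
    (hδ : 0 ≤ δ)
    -- guard, cap, cut-off levels
    {η₀g ηcap ηg ηg2 : ℝ} (hη₀g0 : 0 ≤ η₀g) (hguard : ∀ s ∈ Ico 0 T, ∀ x, ρ s x * σ ^ 3 < η₀g) (hcap0 : 0 ≤ ηcap)
    (hcapev : ∀ s ∈ Icc 0 (t + (m + 1 : ℕ) * Δ + e), ∀ x, rhoC r (Φ.flow s z) x ≤ ρ s x + ηcap)
    (hη₁cap : η₀g + ηcap ≤ η₁) (hg12 : ηg < ηg2) (hη₀gg : η₀g ≤ ηg / 2) (hcapg : ηcap ≤ ηg / 2)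
    -- energy, tail, equation of state, collision rate on the windows
    {KE : ℝ} (hKE0 : 0 ≤ KE) (hKE : ke z ≤ KE) {Lv η₂ : ℝ}
    (htail : hsDiameter σ N / ((N : ℝ) + 1) *
      (∑ᶠ (s : ℝ) (_ : s ∈ collisionTimes (Torus.geometry (Fin 3)) (hsDiameter σ N) (fun s => Φ.flow s z) ∩
        Set.Icc 0 (t + (m + 1 : ℕ) * Δ + e)), ∑ i : Fin (N + 1), ∑ j : Fin (N + 1),
        (if i ≠ j ∧ ‖(Torus.geometry (Fin 3)).sepVec (Φ.flow s z i).1 (Φ.flow s z j).1‖ = hsDiameter σ N then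
          (if Lv < ‖(Φ.flow s z i).2‖ ^ 2 + ‖(Φ.flow s z j).2‖ ^ 2 then
            1 + ‖(Φ.flow s z i).2‖ ^ 2 + ‖(Φ.flow s z j).2‖ ^ 2 else 0) else 0)) ≤ η₂)
    {CY : ℝ} (hCY0 : 0 ≤ CY) (hCY : ∀ a ∈ Set.Icc 0 ηg2, |deriv hsExcessFreeEnergy a| ≤ CY)
    {n : ℕ} (hn : 1 ≤ n) (hne : (t + (m + 1 : ℕ) * Δ) / n ≤ e) {η₃ : ℝ}
    (hcr : ∀ g : Fin (n + 1), |hsDiameter σ N / ((N : ℝ) + 1) *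
      (∑ᶠ (s : ℝ) (_ : s ∈ collisionTimes (Torus.geometry (Fin 3)) (hsDiameter σ N) (fun s => Φ.flow s z) ∩
        Set.Icc 0 (t + (m + 1 : ℕ) * Δ + e)), ∑ i : Fin (N + 1), ∑ j : Fin (N + 1),
        (if i ≠ j ∧ ‖(Torus.geometry (Fin 3)).sepVec (Φ.flow s z i).1 (Φ.flow s z j).1‖ = hsDiameter σ N then
          max 0 (min 1 (min ((s - (g : ℝ) * ((t + (m + 1 : ℕ) * Δ) / n) + (t + (m + 1 : ℕ) * Δ) / n) / ((t + (m + 1 : ℕ) * Δ) / n))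
            (((g : ℝ) * ((t + (m + 1 : ℕ) * Δ) / n) + 2 * ((t + (m + 1 : ℕ) * Δ) / n) - s) / ((t + (m + 1 : ℕ) * Δ) / n)))) *
            max 0 (min 1 ((ηg2 - σ ^ 3 * DensityCapNegative.mollDensity r (Φ.flow s z) (Φ.flow s z i).1) / (ηg2 - ηg)))
          else 0)) -
      σ ^ 3 * ∫ s in Set.Icc (0 : ℝ) (t + (m + 1 : ℕ) * Δ + e), ∫ x : T3,
        max 0 (min 1 (min ((s - (g : ℝ) * ((t + (m + 1 : ℕ) * Δ) / n) + (t + (m + 1 : ℕ) * Δ) / n) / ((t + (m + 1 : ℕ) * Δ) / n))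
            (((g : ℝ) * ((t + (m + 1 : ℕ) * Δ) / n) + 2 * ((t + (m + 1 : ℕ) * Δ) / n) - s) / ((t + (m + 1 : ℕ) * Δ) / n)))) *
          max 0 (min 1 ((ηg2 - σ ^ 3 * DensityCapNegative.mollDensity r (Φ.flow s z) x) / (ηg2 - ηg))) *
          (3 / (2 * Real.pi) * deriv hsExcessFreeEnergy (σ ^ 3 * DensityCapNegative.mollDensity r (Φ.flow s z) x)) *
          ∫ p, cone r p.1.1 x * cone r p.2.1 x * (Real.pi * ‖p.1.2 - p.2.2‖)
            ∂((empiricalMeasure (Φ.flow s z)).prod (empiricalMeasure (Φ.flow s z)))| ≤ η₃)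
    (hcr0 : |hsDiameter σ N / ((N : ℝ) + 1) *
      (∑ᶠ (s : ℝ) (_ : s ∈ collisionTimes (Torus.geometry (Fin 3)) (hsDiameter σ N) (fun s => Φ.flow s z) ∩
        Set.Icc 0 (t + (m + 1 : ℕ) * Δ + e)), ∑ i : Fin (N + 1), ∑ j : Fin (N + 1),
        (if i ≠ j ∧ ‖(Torus.geometry (Fin 3)).sepVec (Φ.flow s z i).1 (Φ.flow s z j).1‖ = hsDiameter σ N then
          max 0 (min 1 (min ((s - 0 + (t + (m + 1 : ℕ) * Δ)) / (t + (m + 1 : ℕ) * Δ))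
            ((0 + 2 * (t + (m + 1 : ℕ) * Δ) - s) / (t + (m + 1 : ℕ) * Δ)))) *
            max 0 (min 1 ((ηg2 - σ ^ 3 * DensityCapNegative.mollDensity r (Φ.flow s z) (Φ.flow s z i).1) / (ηg2 - ηg)))
          else 0)) -
      σ ^ 3 * ∫ s in Set.Icc (0 : ℝ) (t + (m + 1 : ℕ) * Δ + e), ∫ x : T3,
        max 0 (min 1 (min ((s - 0 + (t + (m + 1 : ℕ) * Δ)) / (t + (m + 1 : ℕ) * Δ))
            ((0 + 2 * (t + (m + 1 : ℕ) * Δ) - s) / (t + (m + 1 : ℕ) * Δ)))) *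
          max 0 (min 1 ((ηg2 - σ ^ 3 * DensityCapNegative.mollDensity r (Φ.flow s z) x) / (ηg2 - ηg))) *
          (3 / (2 * Real.pi) * deriv hsExcessFreeEnergy (σ ^ 3 * DensityCapNegative.mollDensity r (Φ.flow s z) x)) *
          ∫ p, cone r p.1.1 x * cone r p.2.1 x * (Real.pi * ‖p.1.2 - p.2.2‖)
            ∂((empiricalMeasure (Φ.flow s z)).prod (empiricalMeasure (Φ.flow s z)))| ≤ η₃)
    -- the classical velocity: bounds, shift moduli, space modulus of the gradient
    {Cu : ℝ} (hCu : 0 ≤ Cu) (hut : ∀ s ∈ Icc 0 (t + (m + 1 : ℕ) * Δ + e), ∀ x, ‖Torus.timeDerivWithin (Ico 0 T) u s x‖ ≤ Cu)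
    (hD : ∀ s ∈ Icc 0 (t + (m + 1 : ℕ) * Δ + e), ∀ x, ∀ i j : Fin 3, |Torus.partialDeriv j (fun y => u s y i) x| ≤ Cu)
    {ω : ℝ} (hω : 0 ≤ ω) (hωu : ∀ s ∈ Icc 0 (t + (m + 1 : ℕ) * Δ), ∀ x, ‖u (s + e) x - u s x‖ ≤ ω)
    (hωt : ∀ s ∈ Icc 0 (t + (m + 1 : ℕ) * Δ), ∀ x,
      ‖Torus.timeDerivWithin (Ico 0 T) u (s + e) x - Torus.timeDerivWithin (Ico 0 T) u s x‖ ≤ ω)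
    (hωD : ∀ s ∈ Icc 0 (t + (m + 1 : ℕ) * Δ), ∀ x, ∀ i j : Fin 3,
      |Torus.partialDeriv j (fun y => u (s + e) y i) x - Torus.partialDeriv j (fun y => u s y i) x| ≤ ω)
    {ωx : ℝ} (hωx0 : 0 ≤ ωx) (hωx : ∀ s ∈ Icc 0 (t + (m + 1 : ℕ) * Δ), ∀ x y : T3, Torus.euclidDist x y < r + hsDiameter σ N →
      ∀ i j : Fin 3, |Torus.partialDeriv j (fun y => u (s + e) y i) x - Torus.partialDeriv j (fun y' => u (s + e) y' i) y| ≤ ωx)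
    -- weak stress isotropy and collisional pressure at the grid times (cut-off inactive under the cap)
    {ηW ηP : ℝ}
    (hW : ∀ g : Fin (n + 1), |∫ s in Icc 0 ((g : ℝ) * ((t + (m + 1 : ℕ) * Δ) / n)), ∫ x,
      max 0 (min 1 ((ηg2 - σ ^ 3 * rhoC r (Φ.flow s z) x) / (ηg2 - ηg))) *
      ∑ j : Fin 3, ∑ k : Fin 3, (Torus.partialDeriv k (fun y => u (max 0 (min s (t + (m + 1 : ℕ) * Δ)) + e) y j) x -
        (if j = k then (∑ l : Fin 3, Torus.partialDeriv l (fun y => u (max 0 (min s (t + (m + 1 : ℕ) * Δ)) + e) y l) x) / 3 else 0)) *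
        (Mmom r (Φ.flow s z) x j k - momC r (Φ.flow s z) x j * momC r (Φ.flow s z) x k / rhoC r (Φ.flow s z) x)| ≤ ηW)
    (hP : ∀ g : Fin (n + 1), |hsDiameter σ N / (N + 1 : ℝ) *
      (∑ᶠ (s : ℝ) (_ : s ∈ collisionTimes (Torus.geometry (Fin 3)) (hsDiameter σ N) (fun s => Φ.flow s z) ∩
        Set.Icc 0 ((g : ℝ) * ((t + (m + 1 : ℕ) * Δ) / n))), ∑ i : Fin (N + 1), ∑ j : Fin (N + 1),
        (if i ≠ j ∧ ‖(Torus.geometry (Fin 3)).sepVec (Φ.flow s z i).1 (Φ.flow s z j).1‖ = hsDiameter σ N then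
          max 0 (min 1 ((ηg2 - σ ^ 3 * rhoC r (Φ.flow s z) (Φ.flow s z i).1) / (ηg2 - ηg))) *
          |⟪(vin (Φ.flow s z) i j).1 - (vin (Φ.flow s z) i j).2, nrm (hsDiameter σ N) (Φ.flow s z) i j⟫_ℝ| *
          ∑ k : Fin 3, ∑ l : Fin 3, (Torus.partialDeriv l (fun y => u (max 0 (min s (t + (m + 1 : ℕ) * Δ)) + e) y k) (Φ.flow s z i).1 +
            Torus.partialDeriv k (fun y => u (max 0 (min s (t + (m + 1 : ℕ) * Δ)) + e) y l) (Φ.flow s z i).1) / 2 *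
            (nrm (hsDiameter σ N) (Φ.flow s z) i j k * nrm (hsDiameter σ N) (Φ.flow s z) i j l) else 0)) -
      2 * ∫ s in Icc 0 ((g : ℝ) * ((t + (m + 1 : ℕ) * Δ) / n)), ∫ x,
        max 0 (min 1 ((ηg2 - σ ^ 3 * rhoC r (Φ.flow s z) x) / (ηg2 - ηg))) *
        (hsPressure σ (rhoC r (Φ.flow s z) x) (thetaC r (Φ.flow s z) x) - rhoC r (Φ.flow s z) x * thetaC r (Φ.flow s z) x) *
        ∑ k : Fin 3, (Torus.partialDeriv k (fun y => u (max 0 (min s (t + (m + 1 : ℕ) * Δ)) + e) y k) x +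
          Torus.partialDeriv k (fun y => u (max 0 (min s (t + (m + 1 : ℕ) * Δ)) + e) y k) x) / 2| ≤ ηP)
    -- the clamped local second law at the entropy grid window starts
    (hθ : Torus.IsSmoothSpaceTimeOn (Ico 0 T) θ)
    {Cθ : ℝ} (hCθ : 0 ≤ Cθ) (hθb : ∀ s ∈ Icc 0 (t + (m + 1 : ℕ) * Δ + e), ∀ x, |θ s x| ≤ Cθ)
    (hθt : ∀ s ∈ Icc 0 (t + (m + 1 : ℕ) * Δ + e), ∀ x, |Torus.timeDerivWithin (Ico 0 T) θ s x| ≤ Cθ)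
    (hθx : ∀ s ∈ Icc 0 (t + (m + 1 : ℕ) * Δ + e), ∀ x, ‖Torus.gradient (θ s) x‖ ≤ Cθ)
    (hωθ : ∀ s ∈ Icc 0 (t + (m + 1 : ℕ) * Δ), ∀ x, |θ (s + e) x - θ s x| ≤ ω)
    (hωθt : ∀ s ∈ Icc 0 (t + (m + 1 : ℕ) * Δ), ∀ x,
      |Torus.timeDerivWithin (Ico 0 T) θ (s + e) x - Torus.timeDerivWithin (Ico 0 T) θ s x| ≤ ω)
    (hωθx : ∀ s ∈ Icc 0 (t + (m + 1 : ℕ) * Δ), ∀ x, ‖Torus.gradient (θ (s + e)) x - Torus.gradient (θ s) x‖ ≤ ω)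
    {C : ℝ} (hC1 : ∀ x, |deriv Real.smoothTransition x| ≤ C) (hC2 : ∀ x, |deriv (deriv Real.smoothTransition) x| ≤ C)
    {n' : ℕ} (hn' : 1 ≤ n') {ηL : ℝ}
    (hL : ∀ g : Fin (n' + 1), (∫ s in Icc 0 (t + (m + 1 : ℕ) * Δ + e), ∫ x,
      (rhoC r (Φ.flow s z) x * max a₁ (min (3 / 2 * Real.log (thetaC r (Φ.flow s z) x) - Real.log (rhoC r (Φ.flow s z) x) -
        (hsExcessFreeEnergy (min (rhoC r (Φ.flow s z) x * σ ^ 3) η₁) +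
          deriv hsExcessFreeEnergy η₁ * max (rhoC r (Φ.flow s z) x * σ ^ 3 - η₁) 0)) b₁) *
        Torus.timeDeriv (fun s' y => Real.smoothTransition ((s' + e / 2) / (e / 4)) * θ (s' + e) y *
          Real.smoothTransition (((g : ℝ) * ((t + (m + 1 : ℕ) * Δ - Δ) / n') + Δ - s') / Δ)) s x +
      max a₁ (min (3 / 2 * Real.log (thetaC r (Φ.flow s z) x) - Real.log (rhoC r (Φ.flow s z) x) -
        (hsExcessFreeEnergy (min (rhoC r (Φ.flow s z) x * σ ^ 3) η₁) +
          deriv hsExcessFreeEnergy η₁ * max (rhoC r (Φ.flow s z) x * σ ^ 3 - η₁) 0)) b₁) *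
        ⟪momC r (Φ.flow s z) x, Torus.gradient (fun y => Real.smoothTransition ((s + e / 2) / (e / 4)) * θ (s + e) y *
          Real.smoothTransition (((g : ℝ) * ((t + (m + 1 : ℕ) * Δ - Δ) / n') + Δ - s) / Δ)) x⟫_ℝ)) +
      ∫ x, rhoC r (Φ.flow 0 z) x * max a₁ (min (3 / 2 * Real.log (thetaC r (Φ.flow 0 z) x) - Real.log (rhoC r (Φ.flow 0 z) x) -
        (hsExcessFreeEnergy (min (rhoC r (Φ.flow 0 z) x * σ ^ 3) η₁) +
          deriv hsExcessFreeEnergy η₁ * max (rhoC r (Φ.flow 0 z) x * σ ^ 3 - η₁) 0)) b₁) *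
        (Real.smoothTransition (((0 : ℝ) + e / 2) / (e / 4)) * θ (0 + e) x *
          Real.smoothTransition (((g : ℝ) * ((t + (m + 1 : ℕ) * Δ - Δ) / n') + Δ - 0) / Δ)) ≤ ηL)
    -- the initial layer
    (hI1 : ∀ x, |rhoC r (Φ.flow 0 z) x - ρ 0 x| ≤ δ) (hI2 : ∀ x, ‖momC r (Φ.flow 0 z) x - ρ 0 x • u 0 x‖ ≤ δ)
    (hI3 : ∀ x, |kinC r (Φ.flow 0 z) x - totalEnergyDensity (ρ 0 x) (u 0 x) (θ 0 x)| ≤ δ)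
    -- the two smallness conditions
    (hS2 : ηW + ηP / 2 + 3 / 2 * Cu * hsDiameter σ N * (2 * (N + 1 : ℝ)⁻¹ + 8 * KE) +
        3 / 2 * ωx * ((1 + max Lv 0) * (η₃ + σ ^ 3 * (3 * (t + (m + 1 : ℕ) * Δ) * (3 / (2 * Real.pi) * CY) *
          (2 * Real.pi * (η₀g / σ ^ 3 + ηcap) * (1 / 2 + KE)))) + η₂) +
        (t + (m + 1 : ℕ) * Δ) / n * ((60 * Cu + 2 * Cu * (1 + B)) * KE) +
        3 / 2 * Cu * ((1 + max Lv 0) * (η₃ + σ ^ 3 * (3 * ((t + (m + 1 : ℕ) * Δ) / n) * (3 / (2 * Real.pi) * CY) *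
          (2 * Real.pi * (η₀g / σ ^ 3 + ηcap) * (1 / 2 + KE)))) + η₂) +
        ω * ((1 + 2 * KE) + (t + (m + 1 : ℕ) * Δ) * ((7 + 2 * B) * KE + 1 / 2)) ≤ δ)
    (hS3 : ηL + ((t + (m + 1 : ℕ) * Δ) * (max |a₁| |b₁| * (Cθ * (C / Δ * ((t + (m + 1 : ℕ) * Δ - Δ) / n'))) * KE +
          (max |a₁| |b₁| * (Cθ * (C / Δ * ((t + (m + 1 : ℕ) * Δ - Δ) / n')) + Cθ * (C / Δ ^ 2 * ((t + (m + 1 : ℕ) * Δ - Δ) / n'))) +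
            max |a₁| |b₁| * (Cθ * (C / Δ * ((t + (m + 1 : ℕ) * Δ - Δ) / n'))) / 2)) +
        max |a₁| |b₁| * Cθ * (C / Δ * ((t + (m + 1 : ℕ) * Δ - Δ) / n'))) +
      ((t + (m + 1 : ℕ) * Δ) * (max |a₁| |b₁| * ω * KE + (max |a₁| |b₁| * (ω + ω * (C / Δ)) + max |a₁| |b₁| * ω / 2)) +
        max |a₁| |b₁| * ω) ≤ δ) :
    ∫ s in Icc t (t + (m + 1 : ℕ) * Δ),
      ((∫ x, |empiricalDensityField (Φ.flow s z) (fun y => cone r y x) - ρ s x|) +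
        (∫ x, ‖empiricalMomentumField (Φ.flow s z) (fun y => cone r y x) - ρ s x • u s x‖) +
        ∫ x, |empiricalEnergyField (Φ.flow s z) (fun y => cone r y x) - totalEnergyDensity (ρ s x) (u s x) (θ s x)|) ≤
      ε' * ((m + 1 : ℕ) * Δ) := by
  -- ### times, the band, the cut-off
  have hm1 : (1 : ℝ) ≤ ((m + 1 : ℕ) : ℝ) := by exact_mod_cast Nat.succ_le_succ (Nat.zero_le m)
  have hΔle : Δ ≤ t + (m + 1 : ℕ) * Δ := by nlinarith
  have htsh0 : 0 ≤ t + (m + 1 : ℕ) * Δ := by linarith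
  have htshp : 0 < t + (m + 1 : ℕ) * Δ := by linarith
  have htshT : t + (m + 1 : ℕ) * Δ < T := by linarith
  have hteT : t + (m + 1 : ℕ) * Δ + e < T := hT
  have hσhalf : σ < 1 / 2 := by rw [one_div]; exact hσ2
  have hσ1 : σ ^ 3 ≤ 1 := pow_le_one₀ hσ.le (by linarith)
  have hσ3 : 0 < σ ^ 3 := by positivity
  have hr2' : r < 2⁻¹ := by rw [inv_eq_one_div]; exact hr2
  have hε : 0 < hsDiameter σ N := hsDiameter_pos hσ N
  have hn0 : (0 : ℝ) < n := by exact_mod_cast hn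
  have hN1 : (0 : ℝ) < (N + 1 : ℝ) := by positivity
  have hγ : IsHardSphereTrajectory (Torus.geometry (Fin 3)) (hsDiameter σ N) (N + 1) fun s => Φ.flow s z := Φ.isTrajectory z hz
  have hu : Torus.IsSmoothSpaceTimeOn (Ico 0 T) u := hE.smooth_velocity
  have hcapσ : ∀ s ∈ Icc 0 (t + (m + 1 : ℕ) * Δ + e), ∀ x, rhoC r (Φ.flow s z) x * σ ^ 3 ≤ η₁ := by
    intro s hs x
    have h1 := hcapev s hs x
    have h2 := hguard s ⟨hs.1, by linarith [hs.2]⟩ x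
    have h3 : rhoC r (Φ.flow s z) x * σ ^ 3 ≤ (ρ s x + ηcap) * σ ^ 3 := mul_le_mul_of_nonneg_right h1 hσ3.le
    nlinarith [mul_le_mul_of_nonneg_left hσ1 hcap0]
  have hcapσ' : ∀ s ∈ Icc 0 (t + (m + 1 : ℕ) * Δ), ∀ x, rhoC r (Φ.flow s z) x * σ ^ 3 ≤ η₁ :=
    fun s hs x => hcapσ s ⟨hs.1, by linarith [hs.2]⟩ x
  have hcut1 : ∀ s ∈ Icc 0 (t + (m + 1 : ℕ) * Δ + e), ∀ x,
      max 0 (min 1 ((ηg2 - σ ^ 3 * rhoC r (Φ.flow s z) x) / (ηg2 - ηg))) = 1 := by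
    intro s hs x
    refine ChaosClosesEulerReadout.cut_eq_one hg12 ?_
    have h1 := hcapev s hs x
    have h2 := hguard s ⟨hs.1, by linarith [hs.2]⟩ x
    have h3 : σ ^ 3 * rhoC r (Φ.flow s z) x ≤ σ ^ 3 * (ρ s x + ηcap) := mul_le_mul_of_nonneg_left h1 hσ3.le
    nlinarith [mul_le_mul_of_nonneg_left hσ1 hcap0]
  -- ### the windowed quadratic collision functional
  have hEz : ((N + 1 : ℕ) : ℝ)⁻¹ * configEnergy z ≤ KE := by rw [← rr_ke_eq]; exact hKE
  have hmesh : 0 < (t + (m + 1 : ℕ) * Δ) / n := div_pos htshp hn0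
  have hτg : ∀ g : Fin (n + 1), 0 ≤ (g : ℝ) * ((t + (m + 1 : ℕ) * Δ) / n) ∧ (g : ℝ) * ((t + (m + 1 : ℕ) * Δ) / n) ≤ t + (m + 1 : ℕ) * Δ := by
    intro g
    refine ⟨by positivity, ?_⟩
    have hg : (g : ℝ) ≤ n := by exact_mod_cast Nat.lt_succ_iff.1 g.2
    calc (g : ℝ) * ((t + (m + 1 : ℕ) * Δ) / n) ≤ n * ((t + (m + 1 : ℕ) * Δ) / n) := mul_le_mul_of_nonneg_right hg hmesh.le
      _ = t + (m + 1 : ℕ) * Δ := by field_simp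
  have hQg : ∀ g : Fin (n + 1), hsDiameter σ N / (N + 1 : ℝ) *
      collisionPairSum (Torus.geometry (Fin 3)) (hsDiameter σ N) (fun s => Φ.flow s z)
        (Ioc ((g : ℝ) * ((t + (m + 1 : ℕ) * Δ) / n)) ((g : ℝ) * ((t + (m + 1 : ℕ) * Δ) / n) + (t + (m + 1 : ℕ) * Δ) / n))
        (fun s i j => 1 + ‖(Φ.flow s z i).2‖ ^ 2 + ‖(Φ.flow s z j).2‖ ^ 2) ≤
      (1 + max Lv 0) * (η₃ + σ ^ 3 * (3 * ((t + (m + 1 : ℕ) * Δ) / n) * (3 / (2 * Real.pi) * CY) *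
        (2 * Real.pi * (η₀g / σ ^ 3 + ηcap) * (1 / 2 + KE)))) + η₂ := fun g =>
    ChaosClosesEulerReadout.kfac_windowQuad_le hσ hσ1 Φ hz (hτg g).1 hmesh (by linarith [(hτg g).2]) hteT hη₀g0 hg12 hη₀gg hcapg
      hcap0 hguard hKE0 hEz hr hr2.le htail hCY0 hCY (hcr g) hcapev
  have hQtot : hsDiameter σ N / (N + 1 : ℝ) *
      collisionPairSum (Torus.geometry (Fin 3)) (hsDiameter σ N) (fun s => Φ.flow s z) (Ioc 0 (t + (m + 1 : ℕ) * Δ))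
        (fun s i j => 1 + ‖(Φ.flow s z i).2‖ ^ 2 + ‖(Φ.flow s z j).2‖ ^ 2) ≤
      (1 + max Lv 0) * (η₃ + σ ^ 3 * (3 * (t + (m + 1 : ℕ) * Δ) * (3 / (2 * Real.pi) * CY) *
        (2 * Real.pi * (η₀g / σ ^ 3 + ηcap) * (1 / 2 + KE)))) + η₂ := by
    have h := ChaosClosesEulerReadout.kfac_windowQuad_le hσ hσ1 Φ hz (t := 0) le_rfl htshp (by linarith) hteT hη₀g0 hg12 hη₀gg
      hcapg hcap0 hguard hKE0 hEz hr hr2.le htail hCY0 hCY hcr0 hcapev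
    rwa [zero_add] at h
  -- ### (H2)
  have hWg : ∀ g : Fin (n + 1), |∫ s in Icc 0 ((g : ℝ) * ((t + (m + 1 : ℕ) * Δ) / n)), ∫ x, ∑ i : Fin 3, ∑ j : Fin 3,
      (Torus.partialDeriv j (fun y => u (s + e) y i) x -
        if i = j then (∑ k : Fin 3, Torus.partialDeriv k (fun y => u (s + e) y k) x) / 3 else 0) *
      (Mmom r (Φ.flow s z) x i j - momC r (Φ.flow s z) x i * momC r (Φ.flow s z) x j / rhoC r (Φ.flow s z) x)| ≤ ηW := by
    intro g
    have h := hW g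
    rwa [setIntegral_congr_fun measurableSet_Icc (fun s hs => ?_)] at h
    have hs' : s ∈ Icc 0 (t + (m + 1 : ℕ) * Δ) := ⟨hs.1, hs.2.trans (hτg g).2⟩
    have hs'' : s ∈ Icc 0 (t + (m + 1 : ℕ) * Δ + e) := ⟨hs.1, by linarith [hs'.2]⟩
    beta_reduce
    simp only [hcut1 s hs'', one_mul, Literature.Analysis.FluidPDE.clamp_eq hs']
  have hmem : ∀ s, (fun s => Φ.flow s z) s ∈ hardSphereDomain (Torus.geometry (Fin 3)) (N + 1) (hsDiameter σ N) := fun s => hγ.mem s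
  have hPg : ∀ g : Fin (n + 1), |hsDiameter σ N / (N + 1 : ℝ) *
        collisionPairSum (Torus.geometry (Fin 3)) (hsDiameter σ N) (fun s => Φ.flow s z) (Icc 0 ((g : ℝ) * ((t + (m + 1 : ℕ) * Δ) / n)))
          (fun s i j => |⟪(vin (Φ.flow s z) i j).1 - (vin (Φ.flow s z) i j).2, nrm (hsDiameter σ N) (Φ.flow s z) i j⟫_ℝ| *
            ∑ k : Fin 3, ∑ l : Fin 3, (Torus.partialDeriv l (fun y => u (max 0 (min s (t + (m + 1 : ℕ) * Δ)) + e) y k) (Φ.flow s z i).1 +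
              Torus.partialDeriv k (fun y => u (max 0 (min s (t + (m + 1 : ℕ) * Δ)) + e) y l) (Φ.flow s z i).1) / 2 *
              (nrm (hsDiameter σ N) (Φ.flow s z) i j k * nrm (hsDiameter σ N) (Φ.flow s z) i j l)) -
      2 * ∫ s in Icc 0 ((g : ℝ) * ((t + (m + 1 : ℕ) * Δ) / n)), ∫ x,
        (hsPressure σ (rhoC r (Φ.flow s z) x) (thetaC r (Φ.flow s z) x) - rhoC r (Φ.flow s z) x * thetaC r (Φ.flow s z) x) *
          ∑ k : Fin 3, (Torus.partialDeriv k (fun y => u (max 0 (min s (t + (m + 1 : ℕ) * Δ)) + e) y k) x +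
            Torus.partialDeriv k (fun y => u (max 0 (min s (t + (m + 1 : ℕ) * Δ)) + e) y k) x) / 2| ≤ ηP := by
    intro g
    have h := hP g
    rw [← collisionPairSum_eq_finsum_ite hmem] at h
    have hfin : (collisionTimes (Torus.geometry (Fin 3)) (hsDiameter σ N) (fun s => Φ.flow s z) ∩
        Icc 0 ((g : ℝ) * ((t + (m + 1 : ℕ) * Δ) / n))).Finite := hγ.locFinite 0 _
    rwa [collisionPairSum_congr_on hfin (g' := fun s i j =>
        |⟪(vin (Φ.flow s z) i j).1 - (vin (Φ.flow s z) i j).2, nrm (hsDiameter σ N) (Φ.flow s z) i j⟫_ℝ| *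
          ∑ k : Fin 3, ∑ l : Fin 3, (Torus.partialDeriv l (fun y => u (max 0 (min s (t + (m + 1 : ℕ) * Δ)) + e) y k) (Φ.flow s z i).1 +
            Torus.partialDeriv k (fun y => u (max 0 (min s (t + (m + 1 : ℕ) * Δ)) + e) y l) (Φ.flow s z i).1) / 2 *
            (nrm (hsDiameter σ N) (Φ.flow s z) i j k * nrm (hsDiameter σ N) (Φ.flow s z) i j l))
        (fun s hs i j => by rw [hcut1 s ⟨hs.1, by linarith [hs.2, (hτg g).2]⟩ _, one_mul]),
      setIntegral_congr_fun measurableSet_Icc (g := fun s => ∫ x,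
        (hsPressure σ (rhoC r (Φ.flow s z) x) (thetaC r (Φ.flow s z) x) - rhoC r (Φ.flow s z) x * thetaC r (Φ.flow s z) x) *
          ∑ k : Fin 3, (Torus.partialDeriv k (fun y => u (max 0 (min s (t + (m + 1 : ℕ) * Δ)) + e) y k) x +
            Torus.partialDeriv k (fun y => u (max 0 (min s (t + (m + 1 : ℕ) * Δ)) + e) y k) x) / 2)
        (fun s hs => by
          beta_reduce
          simp only [hcut1 s ⟨hs.1, by linarith [hs.2, (hτg g).2]⟩, one_mul])] at h
  have H2 : ∀ τ ∈ Icc 0 (t + (m + 1 : ℕ) * Δ), |((∫ x, ⟪u τ x, momC r (Φ.flow τ z) x⟫_ℝ) - (∫ x, ⟪u 0 x, momC r (Φ.flow 0 z) x⟫_ℝ) -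
        ∫ s in Icc 0 τ, ∫ x, (⟪Torus.timeDerivWithin (Ico 0 T) u s x, momC r (Φ.flow s z) x⟫_ℝ +
          ∑ i : Fin 3, ∑ j : Fin 3, Torus.partialDeriv j (fun y => u s y i) x *
            (momC r (Φ.flow s z) x i * momC r (Φ.flow s z) x j / rhoC r (Φ.flow s z) x +
              if i = j then rhoC r (Φ.flow s z) x * thetaC r (Φ.flow s z) x * χe (rhoC r (Φ.flow s z) x) else 0)))| ≤ δ :=
    fun τ hτ => (momentum_pathwise hσ hσ2 Φ hz hr hr2 hu he htsh0 hteT hχ hB0 hB hband hcapσ' hCu hut hD hω hωu hωt hωD hωx0 hωx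
      hKE hn hWg hPg hQg hQtot hτ).trans hS2
  -- ### (H3)
  have H3 := fun τ₀ (hτ₀ : τ₀ ∈ Icc 0 (t + (m + 1 : ℕ) * Δ - Δ)) =>
    (entropy_pathwise hσ Φ hz hr hr2 hθ he hΔ hΔle (by linarith : t + (m + 1 : ℕ) * Δ ≤ t + (m + 1 : ℕ) * Δ + e) hteT
      (a₁ := a₁) (b₁ := b₁) hfband hcapσ' hFc hCθ hθb hθt hθx hω hωθ hωθt hωθx hC1 hC2 hKE hn' hL hτ₀).trans hS3
  -- ### the shell
  have key := hSH (fun s x => (rhoC r (Φ.flow s z) x, momC r (Φ.flow s z) x, kinC r (Φ.flow s z) x))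
    (shell_measurable Φ hz r) (shell_bounded Φ hz hr) (shell_nonneg_admissible Φ z hr).1 (shell_nonneg_admissible Φ z hr).2
  dsimp only at key
  have W := key (shell_mass hσ hσ2 Φ hz hr hr2' _) H2 H3 (shell_energy Φ hz hr hr2 hδ _) (fun x => ⟨hI1 x, hI2 x, hI3 x⟩)
  -- ### the error profile over the tiled window
  obtain ⟨hρc, hmc, hec⟩ := ChaosClosesEulerReadout.euler_continuousOn hE ht0 htshT
  have hint := ChaosClosesEulerReadout.integrableOn_err Φ hz hr hρc hmc hec
  have hslice : ∀ {F : Type} [TopologicalSpace F] {w : ℝ → T3 → F}, ContinuousOn (uncurry w) (Icc t (t + (m + 1 : ℕ) * Δ) ×ˢ univ) →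
      ∀ s ∈ Icc t (t + (m + 1 : ℕ) * Δ), Continuous (w s) := fun hw s hs =>
    hw.comp_continuous (continuous_const.prodMk continuous_id) fun x => ⟨hs, mem_univ _⟩
  have hprof : ∀ s ∈ Icc t (t + (m + 1 : ℕ) * Δ),
      (∫ x, |empiricalDensityField (Φ.flow s z) (fun y => cone r y x) - ρ s x|) +
        (∫ x, ‖empiricalMomentumField (Φ.flow s z) (fun y => cone r y x) - ρ s x • u s x‖) +
        (∫ x, |empiricalEnergyField (Φ.flow s z) (fun y => cone r y x) - totalEnergyDensity (ρ s x) (u s x) (θ s x)|) =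
      ∫ x, (|rhoC r (Φ.flow s z) x - ρ s x| + ‖momC r (Φ.flow s z) x - ρ s x • u s x‖ +
        |kinC r (Φ.flow s z) x - totalEnergyDensity (ρ s x) (u s x) (θ s x)|) := fun s hs =>
    stub_reductionPathwise r (Φ.flow s z) (hslice hρc s hs) (hslice hmc s hs) (hslice hec s hs)
  rw [setIntegral_congr_fun measurableSet_Icc hprof]
  refine shell_windows_sum_le hΔ m (hint.congr_fun hprof measurableSet_Icc) fun j hj => ?_
  have hjm : (j : ℝ) ≤ m := by exact_mod_cast Nat.lt_succ_iff.1 hj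
  have hj0 : (0 : ℝ) ≤ j := Nat.cast_nonneg j
  refine W (t + j * Δ) ⟨by positivity, ?_⟩
  push_cast
  nlinarith

end Summit.AtomisticToContinuum.HydrodynamicLimit.Theorems.ChaosClosesEulerReduction

end
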